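import Summits.BirchSwinnertonDyer.Rank1Residual.X2.GreenbergVatsalTateDatumRat
import Summits.BirchSwinnertonDyer.Rank1Residual.X2.GreenbergVatsalTateDatumTorsion
import Summits.BirchSwinnertonDyer.Rank1Residual.X2.GreenbergVatsalTransferCurve
import Literature.NumberTheory.EllipticCurves.BSDConductorProofs
import HarnessLib

/-!
# The Greenberg–Vatsal transfer at `p ‖ N` (the X2 member of a route-G pair): Tate data over `ℚ`
# with EVERY datum hypothesis discharged, finiteness of `E(ℚ_∞)[p^∞]`, and the assembled
# "independent of `i`" for MIXED and MULTIPLICATIVE pairs — conditional only on the published Tate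
# uniformisation (Silverman *ATAEC* V.5.2–5.4)

HONEST FRAMING (cell `b2b-bsdres`, run/shared/lean/b2b/bsd-rank1-residual/, verbatim in every
file): the goal of the cell is to DELETE the COMBINATION-SHAPED residual classes of the
Birch–Swinnerton-Dyer formula for ALL analytic-rank `≤ 1` elliptic curves over `ℚ` — "full BSD
formula for every rank `≤ 1` curve in class `C`" assembled STRICTLY from published theorems — so
that the rank-`≤ 1` remainder becomes exactly the CONSTRUCTION-SHAPED classes, which are TYPED
(missing-input `Prop`s), NOT attempted. This is not "finishing BSD". Sub-cell
`b2b-bsdres-eisenstein-p2` (CLASS-OWNERS row "X2"), gen 9: research route; NO CLAIM BEYOND STATED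
CLASSES; nothing here changes a label. Theorems only (no `def`, no NEW named fact); everything here
is CONDITIONAL on the tree's named fact `Silverman1994_thmV53_corV54_tateUniformisation` (Silverman
*ATAEC* Lemma V.5.2 (c), Thm. V.5.3, Cor. V.5.4 — PUBLISHED; hypothesis `hT`), the only non-theorem
input of the whole `p ‖ N` chain.

WHAT THIS FILE PROVES (the X2 side of route G, X2-GAP §14; `E/ℚ` globally minimal, `p` ODD with
`p ‖ N`, `κ` the cyclotomic `ℤ_p`-extension where finiteness is used):
* `exists_data_rat` — Tate data `L` above `p` with GV's three datum hypotheses DISCHARGED: "`I_p`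
  trivial on `D`" (`tateDatum_htriv`), the Kummer compatibility (`tateDatum_kummer`), "`I_p` moves
  every point of `C[p]`" (`tateDatum_hgen`) — the unramifiedness input `ht` being
  `GreenbergVatsalTateDatumRat.inertia_fix_sqrt_gamma`;
* `finite_fixedPoints_kerSubgroup_of_hasMultiplicativeReductionAtPrime` — `E(ℚ_∞)[p^∞]` is FINITE
  (`= E(ℚ)[p^∞]`; `GreenbergVatsalTateDatumTorsion`), the hypothesis `[Finite (invariants H M)]` of
  the kernel comparison at `p ‖ N` (GV p. 26 "known to be finite" — now a theorem modulo `hT`);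
* **`exists_data_natCard_gvSelmerInfty_inf_torsion_eq_mixed`** — for a MIXED pair (`E₁` with
  `p ‖ N₁`, `E₂` good ordinary at `p`; `Σ₀ ⊇` bad primes `≠ p` of both; route G's
  `X1.CongruenceTransfer.TorsionIso E₁ E₂ p`): `#(S^{Σ₀}_{E₁[p^∞]}(ℚ_∞) ⊓ H¹[p]) =
  #(S^{Σ₀}_{E₂[p^∞]}(ℚ_∞) ⊓ H¹[p])` for Tate data of `E₁` and Greenberg's datum of `E₂`;
* **`exists_data_natCard_gvSelmerInfty_inf_torsion_eq_mult`** — the same for two multiplicative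
  members.
Together with `GreenbergVatsalTransferCurve` (two good-ordinary members, UNCONDITIONAL) this is
Greenberg–Vatsal p. 27 "the order of this group is independent of `i`" for EVERY route-G pair of the
cell at an odd prime (good ordinary or multiplicative members), WITHOUT `H⁰(ℚ, E_i[p]) = 0` and
without correction terms. WHAT STAYS PRINTED: the passage to `λ` (`#S^{Σ₀}_A[p] = p^{λ^{Σ₀}}` at
`μ = 0`, GV Prop. (2.8)/(2.5); `λ^{Σ₀} = λ + Σ s_ℓ d_ℓ`, Cor. (2.3)/Prop. (2.4); `Sel = S_A`,
`λ(S_A) = λ(Sel) + e_p`, Greenberg 1999 §2 / GV pp. 14–15) and the Tate uniformisation itself.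

References: Greenberg–Vatsal 2000, §2 Prop. (2.8), pp. 14–15, 25–27; Greenberg, LNM 1716, §1 p. 62;
Silverman, *ATAEC* Ch. V Lemma 5.2, Thm. 5.3, Cor. 5.4.
-/

noncomputable section

open scoped Classical AddSubgroup

open NumberField IsDedekindDomain Field
open Literature.NumberTheory.EllipticCurves Literature.NumberTheory.EllipticCurves.GreenbergSelmer
  Literature.NumberTheory.GaloisRepresentations IsDedekindDomain.HeightOneSpectrum
  Summit.BirchSwinnertonDyer.Rank1Residual.X2.TorsionComparison
  Summit.BirchSwinnertonDyer.Rank1Residual.X2.GreenbergVatsalTorsion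
  Summit.BirchSwinnertonDyer.Rank1Residual.X2.GreenbergVatsalTorsionCurve
  Summit.BirchSwinnertonDyer.Rank1Residual.X2.GreenbergVatsalTateDatum
  Summit.BirchSwinnertonDyer.Rank1Residual.X2.GreenbergVatsalTateDatumRat
  Summit.BirchSwinnertonDyer.Rank1Residual.X2.GreenbergVatsalTateDatumTorsion
  Summit.BirchSwinnertonDyer.Rank1Residual.X2.GreenbergVatsalReductionDatum
  Summit.BirchSwinnertonDyer.Rank1Residual.X2.GreenbergVatsalReductionDatumLine
  Summit.BirchSwinnertonDyer.Rank1Residual.X2.GreenbergVatsalTorsionInvariants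
  Summit.BirchSwinnertonDyer.Rank1Residual.X2.GreenbergVatsalTransferCurve

namespace Summit.BirchSwinnertonDyer.Rank1Residual.X2.GreenbergVatsalTransferMultiplicative

/-! ## §1. Tate data of `E/ℚ` at an odd `p ‖ N` with `htriv`, Kummer, `hgen`; finiteness of `E(ℚ_∞)[p^∞]` -/

section Data

variable (W : WeierstrassCurve ℚ) [W.IsElliptic] [W.IsGloballyMinimal] (p : ℕ) [hp : Fact p.Prime]

omit [W.IsGloballyMinimal] in
/-- Prime-indexed to place-indexed multiplicative reduction over `ℚ` (tree
`hasMultiplicativeReductionAtPrime_iff_hasMultiplicativeReductionAt_ringOfIntegers`). [folklore] -/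
theorem hasMultiplicativeReductionAt_of_natCast_mem (hmult : W.HasMultiplicativeReductionAtPrime p)
    {v : HeightOneSpectrum (𝓞 ℚ)} (hv : ((p : ℕ) : 𝓞 ℚ) ∈ v.asIdeal) :
    W.HasMultiplicativeReductionAt v := by
  have hvp : (Rat.HeightOneSpectrum.primesEquiv v : ℕ) = p :=
    Rat.HeightOneSpectrum.primesEquiv_eq_of_natCast_mem v hp.out hv
  have h := W.hasMultiplicativeReductionAtPrime_iff_hasMultiplicativeReductionAt_ringOfIntegers v
  subst hvp
  exact h.mp hmult

/-- **Tate data above `p` for a globally minimal `E/ℚ` at an ODD prime of multiplicative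
reduction (split or non-split), with GV's three datum hypotheses DISCHARGED** — "`I_p` trivial on
`D`" (`htriv`), the Kummer compatibility, and "`I_p` moves every point of `C[p]`" (`hgen`) —
granted the PUBLISHED twisted Tate uniformisation (`hT`; Silverman *ATAEC* V.5.2–5.4). The
unramifiedness of `√γ` is `inertia_fix_sqrt_gamma`.
[cite: SilvermanATAEC1994, Ch. V Lemma 5.2 (c), Thm. 5.3 (a),(b), Cor. 5.4 (held copy PDF pp. 406–410)]
[cite: GreenbergVatsal2000, §2 pp. 14–15 and p. 26] -/
theorem exists_data_rat (hT : Silverman1994_thmV53_corV54_tateUniformisation.{0}) (hp2 : p ≠ 2)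
    (hmult : W.HasMultiplicativeReductionAtPrime p) :
    ∃ L : Data ℚ (W.geomPrimaryTorsion p) p,
      (∀ (v : HeightOneSpectrum (𝓞 ℚ)) (hv : ((p : ℕ) : 𝓞 ℚ) ∈ v.asIdeal),
        ∀ x ∈ inertia v, ∀ m : W.geomPrimaryTorsion p, x • m - m ∈ (L v hv).plus) ∧
      (∀ (v : HeightOneSpectrum (𝓞 ℚ)) (hv : ((p : ℕ) : 𝓞 ℚ) ∈ v.asIdeal),
        ∀ σ ∈ absInertia (v.adicCompletion ℚ), ∀ (P : localPoints W (v.adicCompletion ℚ))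
          (m : W.geomPrimaryTorsion p),
          pointsMap W (v.adicCompletion ℚ) (m : W.geomPoints) = σ • P - P → m ∈ (L v hv).plus) ∧
      (∀ (v : HeightOneSpectrum (𝓞 ℚ)) (hv : ((p : ℕ) : 𝓞 ℚ) ∈ v.asIdeal),
        ∀ c ∈ (torsionData L p v hv).plus, ∃ τ ∈ inertia v,
          ∃ c' ∈ (torsionData L p v hv).plus, τ • c' - c' = c) := by
  have hmultv : ∀ v : HeightOneSpectrum (𝓞 ℚ), ((p : ℕ) : 𝓞 ℚ) ∈ v.asIdeal →
      W.HasMultiplicativeReductionAt v := fun v hv ↦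
    hasMultiplicativeReductionAt_of_natCast_mem W p hmult hv
  have key : ∀ (v : HeightOneSpectrum (𝓞 ℚ)) (hv : ((p : ℕ) : 𝓞 ℚ) ∈ v.asIdeal),
      ∃ N : LocalDatum ℚ (W.geomPrimaryTorsion p) v,
        (∀ x ∈ inertia v, ∀ m : W.geomPrimaryTorsion p, x • m - m ∈ N.plus) ∧
        (∀ σ ∈ absInertia (v.adicCompletion ℚ), ∀ (P : localPoints W (v.adicCompletion ℚ))
          (m : W.geomPrimaryTorsion p),
          pointsMap W (v.adicCompletion ℚ) (m : W.geomPoints) = σ • P - P → m ∈ N.plus) ∧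
        (∀ c ∈ (torsionDatum N p).plus, ∃ τ ∈ inertia v,
          ∃ c' ∈ (torsionDatum N p).plus, τ • c' - c' = c) := by
    intro v hv
    obtain ⟨q, t, Ψ, hq0, hq1, -, ht2, hsurj, hker, hΨσ, -⟩ := hT W v (hmultv v hv)
    have ht := inertia_fix_sqrt_gamma W hp2 hmult hv t ht2
    have hΨ : ∀ (σ : absoluteGaloisGroup (v.adicCompletion ℚ))
        (u : (AlgebraicClosure (v.adicCompletion ℚ))ˣ),
        σ • Ψ (Additive.ofMul u) = Ψ (Additive.ofMul (Units.map
          (Field.absoluteGaloisGroup.toAlgEquiv (v.adicCompletion ℚ) σ :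
            AlgebraicClosure (v.adicCompletion ℚ) →* AlgebraicClosure (v.adicCompletion ℚ)) u)) ∨
        σ • Ψ (Additive.ofMul u) = -Ψ (Additive.ofMul (Units.map
          (Field.absoluteGaloisGroup.toAlgEquiv (v.adicCompletion ℚ) σ :
            AlgebraicClosure (v.adicCompletion ℚ) →* AlgebraicClosure (v.adicCompletion ℚ)) u)) := by
      intro σ u
      rw [hΨσ σ u]
      split_ifs
      · exact Or.inl (one_zsmul _)
      · exact Or.inr (neg_one_zsmul _)
    have hΨI : ∀ σ ∈ absInertia (v.adicCompletion ℚ),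
        ∀ u : (AlgebraicClosure (v.adicCompletion ℚ))ˣ,
        σ • Ψ (Additive.ofMul u) = Ψ (Additive.ofMul (Units.map
          (Field.absoluteGaloisGroup.toAlgEquiv (v.adicCompletion ℚ) σ :
            AlgebraicClosure (v.adicCompletion ℚ) →* AlgebraicClosure (v.adicCompletion ℚ)) u)) := by
      intro σ hσ u
      rw [hΨσ σ u, if_pos (ht σ hσ), one_zsmul]
    exact ⟨tateDatum W p Ψ hΨ, tateDatum_htriv W p Ψ hΨ hsurj (fun u h ↦ (hker u).1 h) hΨI,
      tateDatum_kummer W p Ψ hΨ hsurj (fun u h ↦ (hker u).1 h) hΨI hq0 hq1,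
      tateDatum_hgen W p Ψ hΨ hq0 hq1 (fun u h ↦ (hker u).1 h) hΨI hp2 hv⟩
  choose N hN₁ hN₂ hN₃ using key
  exact ⟨N, hN₁, hN₂, hN₃⟩

/-- **`E(ℚ_∞)[p^∞]` is finite for the cyclotomic `ℤ_p`-extension at an ODD prime `p ‖ N`** of the
globally minimal `E/ℚ` (it equals `E(ℚ)[p^∞]`), granted the published twisted Tate uniformisation
(`hT`): `GreenbergVatsalTateDatumTorsion.finite_fixedPoints_kerSubgroup` at the place over `p`.
[cite: GreenbergLNM1716, §1 p. 62; §3 p. 86] [cite: GreenbergVatsal2000, §2 p. 26] -/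
theorem finite_fixedPoints_kerSubgroup_of_hasMultiplicativeReductionAtPrime
    (hT : Silverman1994_thmV53_corV54_tateUniformisation.{0}) (hp2 : p ≠ 2)
    (hmult : W.HasMultiplicativeReductionAtPrime p) (κ : ZpExtension ℚ p) (hκ : κ.IsCyclotomic) :
    Finite (FixedPoints.addSubgroup κ.kerSubgroup (W.geomPrimaryTorsion p)) := by
  set v : HeightOneSpectrum (𝓞 ℚ) := (Rat.HeightOneSpectrum.primesEquiv (R := 𝓞 ℚ)).symm ⟨p, hp.out⟩
    with hvdef
  have hv : ((p : ℕ) : 𝓞 ℚ) ∈ v.asIdeal :=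
    (natCast_mem_asIdeal_iff_eq_primesEquiv_symm v hp.out).mpr hvdef
  have hmultv : W.HasMultiplicativeReductionAt v :=
    hasMultiplicativeReductionAt_of_natCast_mem W p hmult hv
  obtain ⟨q, t, Ψ, hq0, hq1, -, ht2, hsurj, hker, hΨσ, -⟩ := hT W v hmultv
  have ht := inertia_fix_sqrt_gamma W hp2 hmult hv t ht2
  have hΨ : ∀ (σ : absoluteGaloisGroup (v.adicCompletion ℚ))
      (u : (AlgebraicClosure (v.adicCompletion ℚ))ˣ),
      σ • Ψ (Additive.ofMul u) = Ψ (Additive.ofMul (Units.map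
        (Field.absoluteGaloisGroup.toAlgEquiv (v.adicCompletion ℚ) σ :
          AlgebraicClosure (v.adicCompletion ℚ) →* AlgebraicClosure (v.adicCompletion ℚ)) u)) ∨
      σ • Ψ (Additive.ofMul u) = -Ψ (Additive.ofMul (Units.map
        (Field.absoluteGaloisGroup.toAlgEquiv (v.adicCompletion ℚ) σ :
          AlgebraicClosure (v.adicCompletion ℚ) →* AlgebraicClosure (v.adicCompletion ℚ)) u)) := by
    intro σ u
    rw [hΨσ σ u]
    split_ifs
    · exact Or.inl (one_zsmul _)
    · exact Or.inr (neg_one_zsmul _)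
  have hΨI : ∀ σ ∈ absInertia (v.adicCompletion ℚ),
      ∀ u : (AlgebraicClosure (v.adicCompletion ℚ))ˣ,
      σ • Ψ (Additive.ofMul u) = Ψ (Additive.ofMul (Units.map
        (Field.absoluteGaloisGroup.toAlgEquiv (v.adicCompletion ℚ) σ :
          AlgebraicClosure (v.adicCompletion ℚ) →* AlgebraicClosure (v.adicCompletion ℚ)) u)) := by
    intro σ hσ u
    rw [hΨσ σ u, if_pos (ht σ hσ), one_zsmul]
  exact finite_fixedPoints_kerSubgroup W p Ψ hΨ hq0 hq1 (fun u h ↦ (hker u).1 h) hΨI κ hκ hp2 hv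
    hsurj

end Data

/-! ## §2. The assembled transfer with a multiplicative member -/

section Transfer

variable (W₁ W₂ : WeierstrassCurve ℚ) [W₁.IsElliptic] [W₁.IsGloballyMinimal] [W₂.IsElliptic]
  [W₂.IsGloballyMinimal] {p : ℕ} [hp : Fact p.Prime] (κ : ZpExtension ℚ p)
  (S₀ : Set (HeightOneSpectrum (𝓞 ℚ)))

/-- **"Independent of `i`" for a MIXED route-G pair** (the generic X2 situation: `E₁/ℚ` with
`p ‖ N₁` — the X2 member —, `E₂/ℚ` good ordinary at `p` — e.g. an X1-type partner): `p` odd, `κ`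
cyclotomic, `Σ₀ ⊇` bad primes `≠ p` of both, `TorsionIso E₁ E₂ p`; granted the published twisted
Tate uniformisation (`hT`). Then for SOME Tate data `L₁` above `p` satisfying GV's `htriv` (all of
them do) and Greenberg's datum of `E₂`:
`#(S^{Σ₀}_{E₁[p^∞]}(ℚ_∞) ⊓ H¹[p]) = #(S^{Σ₀}_{E₂[p^∞]}(ℚ_∞) ⊓ H¹[p])`.
[cite: GreenbergVatsal2000, §2 Prop. (2.8) and pp. 26–27]
[cite: SilvermanATAEC1994, Ch. V Lemma 5.2 (c), Thm. 5.3 (a),(b), Cor. 5.4 (held copy PDF pp. 406–410)] -/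
theorem exists_data_natCard_gvSelmerInfty_inf_torsion_eq_mixed
    (hT : Silverman1994_thmV53_corV54_tateUniformisation.{0}) (hp2 : p ≠ 2)
    (hmult₁ : W₁.HasMultiplicativeReductionAtPrime p)
    (hgood₂ : W₂.HasGoodReductionAtPrime p) (hord₂ : ¬ (p : ℤ) ∣ W₂.frobeniusTrace p)
    (hκ : κ.IsCyclotomic)
    (hS₁ : ∀ v : HeightOneSpectrum (𝓞 ℚ), v ∉ S₀ → ((p : ℕ) : 𝓞 ℚ) ∉ v.asIdeal →
      W₁.HasGoodReductionAt v)
    (hS₂ : ∀ v : HeightOneSpectrum (𝓞 ℚ), v ∉ S₀ → ((p : ℕ) : 𝓞 ℚ) ∉ v.asIdeal →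
      W₂.HasGoodReductionAt v)
    (hiso : X1.CongruenceTransfer.TorsionIso W₁ W₂ p) :
    ∃ L₁ : Data ℚ (W₁.geomPrimaryTorsion p) p,
      (∀ (v : HeightOneSpectrum (𝓞 ℚ)) (hv : ((p : ℕ) : 𝓞 ℚ) ∈ v.asIdeal),
        ∀ x ∈ inertia v, ∀ m : W₁.geomPrimaryTorsion p, x • m - m ∈ (L₁ v hv).plus) ∧
      Nat.card (gvSelmerInfty κ (W₁.geomPrimaryTorsion p) L₁ S₀ ⊓
          (subgroupH1 κ.kerSubgroup (W₁.geomPrimaryTorsion p))[(p : ℤ)] :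
          AddSubgroup (subgroupH1 κ.kerSubgroup (W₁.geomPrimaryTorsion p))) =
        Nat.card (gvSelmerInfty κ (W₂.geomPrimaryTorsion p)
          (reductionData W₂ p (W₂.not_dvd_minimalDiscriminantInt_of_hasGoodReductionAtPrime' p hgood₂))
          S₀ ⊓ (subgroupH1 κ.kerSubgroup (W₂.geomPrimaryTorsion p))[(p : ℤ)] :
          AddSubgroup (subgroupH1 κ.kerSubgroup (W₂.geomPrimaryTorsion p))) := by
  obtain ⟨L₁, hL₁triv, -, hL₁gen⟩ := exists_data_rat W₁ p hT hp2 hmult₁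
  obtain ⟨θ, hθ⟩ := GreenbergVatsalTransferCurve.exists_equiv_of_torsionIso hiso
  haveI : Finite (invariants κ.kerSubgroup (W₁.geomPrimaryTorsion p)) :=
    finite_fixedPoints_kerSubgroup_of_hasMultiplicativeReductionAtPrime W₁ p hT hp2 hmult₁ κ hκ
  haveI : Finite (invariants κ.kerSubgroup (W₂.geomPrimaryTorsion p)) :=
    W₂.finite_fixedPoints_kerSubgroup_geomPrimaryTorsion_of_ordinary κ hp2 hgood₂ hord₂ hκ
  exact ⟨L₁, hL₁triv, natCard_gvSelmer_inf_torsion_eq_of_inertia κ.kerSubgroup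
    (W₁.geomPrimaryTorsion p) (W₂.geomPrimaryTorsion p) p L₁ _ S₀ p (continuous_smul_curve W₁ p)
    (continuous_smul_curve W₂ p) (divisible_curve W₁ p) (divisible_curve W₂ p)
    (unramified_outside W₁ p S₀ hS₁) (unramified_outside W₂ p S₀ hS₂) hL₁triv
    (reductionData_htriv W₂ p _) hL₁gen (reductionData_hgen W₂ p hp2 _ hord₂) θ hθ⟩

/-- **"Independent of `i`" for two MULTIPLICATIVE members** (`p ‖ N₁`, `p ‖ N₂`, `p` odd, `κ`
cyclotomic, `Σ₀ ⊇` bad primes `≠ p` of both, `TorsionIso E₁ E₂ p`; granted `hT`): for some Tate data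
`L₁, L₂` above `p` (with `htriv`),
`#(S^{Σ₀}_{E₁[p^∞]}(ℚ_∞) ⊓ H¹[p]) = #(S^{Σ₀}_{E₂[p^∞]}(ℚ_∞) ⊓ H¹[p])`.
[cite: GreenbergVatsal2000, §2 Prop. (2.8) and pp. 26–27]
[cite: SilvermanATAEC1994, Ch. V Lemma 5.2 (c), Thm. 5.3 (a),(b), Cor. 5.4 (held copy PDF pp. 406–410)] -/
theorem exists_data_natCard_gvSelmerInfty_inf_torsion_eq_mult
    (hT : Silverman1994_thmV53_corV54_tateUniformisation.{0}) (hp2 : p ≠ 2)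
    (hmult₁ : W₁.HasMultiplicativeReductionAtPrime p) (hmult₂ : W₂.HasMultiplicativeReductionAtPrime p)
    (hκ : κ.IsCyclotomic)
    (hS₁ : ∀ v : HeightOneSpectrum (𝓞 ℚ), v ∉ S₀ → ((p : ℕ) : 𝓞 ℚ) ∉ v.asIdeal →
      W₁.HasGoodReductionAt v)
    (hS₂ : ∀ v : HeightOneSpectrum (𝓞 ℚ), v ∉ S₀ → ((p : ℕ) : 𝓞 ℚ) ∉ v.asIdeal →
      W₂.HasGoodReductionAt v)
    (hiso : X1.CongruenceTransfer.TorsionIso W₁ W₂ p) :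
    ∃ (L₁ : Data ℚ (W₁.geomPrimaryTorsion p) p) (L₂ : Data ℚ (W₂.geomPrimaryTorsion p) p),
      (∀ (v : HeightOneSpectrum (𝓞 ℚ)) (hv : ((p : ℕ) : 𝓞 ℚ) ∈ v.asIdeal),
        ∀ x ∈ inertia v, ∀ m : W₁.geomPrimaryTorsion p, x • m - m ∈ (L₁ v hv).plus) ∧
      (∀ (v : HeightOneSpectrum (𝓞 ℚ)) (hv : ((p : ℕ) : 𝓞 ℚ) ∈ v.asIdeal),
        ∀ x ∈ inertia v, ∀ m : W₂.geomPrimaryTorsion p, x • m - m ∈ (L₂ v hv).plus) ∧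
      Nat.card (gvSelmerInfty κ (W₁.geomPrimaryTorsion p) L₁ S₀ ⊓
          (subgroupH1 κ.kerSubgroup (W₁.geomPrimaryTorsion p))[(p : ℤ)] :
          AddSubgroup (subgroupH1 κ.kerSubgroup (W₁.geomPrimaryTorsion p))) =
        Nat.card (gvSelmerInfty κ (W₂.geomPrimaryTorsion p) L₂ S₀ ⊓
          (subgroupH1 κ.kerSubgroup (W₂.geomPrimaryTorsion p))[(p : ℤ)] :
          AddSubgroup (subgroupH1 κ.kerSubgroup (W₂.geomPrimaryTorsion p))) := by
  obtain ⟨L₁, hL₁triv, -, hL₁gen⟩ := exists_data_rat W₁ p hT hp2 hmult₁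
  obtain ⟨L₂, hL₂triv, -, hL₂gen⟩ := exists_data_rat W₂ p hT hp2 hmult₂
  obtain ⟨θ, hθ⟩ := GreenbergVatsalTransferCurve.exists_equiv_of_torsionIso hiso
  haveI : Finite (invariants κ.kerSubgroup (W₁.geomPrimaryTorsion p)) :=
    finite_fixedPoints_kerSubgroup_of_hasMultiplicativeReductionAtPrime W₁ p hT hp2 hmult₁ κ hκ
  haveI : Finite (invariants κ.kerSubgroup (W₂.geomPrimaryTorsion p)) :=
    finite_fixedPoints_kerSubgroup_of_hasMultiplicativeReductionAtPrime W₂ p hT hp2 hmult₂ κ hκ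
  exact ⟨L₁, L₂, hL₁triv, hL₂triv, natCard_gvSelmer_inf_torsion_eq_of_inertia κ.kerSubgroup
    (W₁.geomPrimaryTorsion p) (W₂.geomPrimaryTorsion p) p L₁ L₂ S₀ p (continuous_smul_curve W₁ p)
    (continuous_smul_curve W₂ p) (divisible_curve W₁ p) (divisible_curve W₂ p)
    (unramified_outside W₁ p S₀ hS₁) (unramified_outside W₂ p S₀ hS₂) hL₁triv hL₂triv hL₁gen hL₂gen
    θ hθ⟩

end Transfer

end Summit.BirchSwinnertonDyer.Rank1Residual.X2.GreenbergVatsalTransferMultiplicative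

end
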